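import Mathlib
import Summits.NavierStokesRegularity.NavierStokesRegularity.Theorems.FilamentSkeletonRssTangentSkeletonLCurveCore
import Summits.NavierStokesRegularity.NavierStokesRegularity.Theorems.FilamentSkeletonRssNormalBlockMatchedL

/-!
# `SkeletonJ1L` (stmt-NavierStokesRegularity-23296) needs its heart `TangentSkeletonNearStraightL` (stmt-23320) for ONE datum only:
# the parent BY NAME from the unit-core CURVE CORE AT THE LANDED `R_π`-SYMMETRIC PAIR and the clause-13 child alone

The registered split of record proves `SkeletonJ1L ⇐ TangentSkeletonNearStraightL ∧ Clause13NearStraightL ∧ NormalBlockMatchedL`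
(`Theorems.FilamentSkeletonRssSkeletonJ1LSplit.skeletonJ1L_of_children`), feeding the ∀-datum heart ⟨23320⟩ with the ONE landed general-position datum
`straightDatumGP_exists` (`N = 2`, `p = (±2/25, 0, 0)`, `t = (0, ±3/5, 4/5)`, `γ₀ = γ₁ = 125π/108`, `α = 875/432`, box `θd = 1/6`).  Two facts sharpen the
planner's picture of what the PARENT actually consumes:
(1) the normal-block child ⟨23322⟩ is a THEOREM (`Theorems.FilamentSkeletonRssNormalBlockMatchedL.stub_normalBlockL`);
(2) the heart is used at that single datum, and — by `Theorems.TangentSkeletonLCurveCore` (p837172) — only through its unit-core CURVE CORE.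
`skeletonJ1L_of_pairCurveCore` records the consequence as an importable sorry-free theorem: `Theses.FilamentSkeletonRss.SkeletonJ1L` BY NAME from
  (h1) the SINGLE-DATUM curve core — box constants (`2Kρ ≤ 1`, `Λ ≥ 1`), `Rb₁ > 0`, and for all `0 < Rb ≤ Rb₁`, all large `Γ`, two unit-speed `C²` curves with
       slips and zeros satisfying the twelve curve clauses of `FlatJ1L` for the UNIT-CORE field with `N = 2`, `γ ≡ 125π/108`, `α = 875/432`, tangent
       oscillation `≤ Rb`, `|w′| ≤ Λ` (an `R_π`-symmetric pair is allowed but not required), and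
  (h3) the clause-13 child `Theses.FilamentSkeletonRss.Clause13NearStraightL` (stmt-23321, open),
with ⟨23322⟩ discharged by name and the constants threaded exactly as in the glue of record (`Rb := min Rb₀ Rb₁`, `η := 1`, `Γ₂ := max Γ₂ (max Γ₀ Γ₁)`).
So a line for the PARENT may build the skeleton for this one symmetric pair (strategist S⁺8 «symmetry-class construction»: Newton inside the
`R_π`-symmetric class, even sector only), while ⟨23320⟩ as typed (∀ general-position data) is strictly more than the route consumes.
HONEST FRAMING: bookkeeping (pure logic over landed theorems) about a HYPOTHETICAL filament skeleton on the NEGATIVE side of a MODEL route; neither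
⟨23320⟩ nor ⟨23321⟩ nor the parent ⟨23296⟩ is proved here; nothing bears on Navier–Stokes regularity or blow-up.
`--supports stmt-NavierStokesRegularity-23296` (parent of 23320; same route). [folklore]
-/

set_option linter.dupNamespace false

noncomputable section

namespace Summit.NavierStokesRegularity.NavierStokesRegularity.Theorems.SkeletonJ1LSingleDatum

open Filter
open scoped InnerProductSpace BigOperators
open Literature.Analysis.FluidPDE
open Summit.NavierStokesRegularity.NavierStokesRegularity.Theorems.FilamentSkeletonRssSkeletonJ1GSplit
  (Clause12J1G Clause13J1G NearStraightJ1G StraightDatum)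
open Summit.NavierStokesRegularity.NavierStokesRegularity.Theorems.FilamentSkeletonRssSkeletonJ1LSplit
  (J1LMatrix FlatJ1L Clause13NearStraightLS NormalBlockMatchedLS skeletonJ1L_iff_matrix route_clause13NearStraightL_iff
    route_normalBlockMatchedL_iff)
open Summit.NavierStokesRegularity.NavierStokesRegularity.Theorems.TangentSkeletonLCurveCore
open Summit.NavierStokesRegularity.NavierStokesRegularity.Theorems.FilamentSkeletonRssNormalBlockMatchedL (stub_normalBlockL)

/-- ★ **`SkeletonJ1L` BY NAME from the single-datum unit-core curve core at the landed symmetric pair and the clause-13 child.** [folklore] -/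
theorem skeletonJ1L_of_pairCurveCore
    (h1 : ∃ (δ ρ K Λ Rw cg θ₀ Rb₁ : ℝ), 0 < δ ∧ 0 < ρ ∧ 0 < Rw ∧ 0 < cg ∧ 0 < θ₀ ∧ 0 < Rb₁ ∧ 2 * K * ρ ≤ 1 ∧ 1 ≤ Λ ∧
        ∀ Rb : ℝ, 0 < Rb → Rb ≤ Rb₁ → ∃ Γ₂ : ℝ, ∀ Γ : ℝ, Γ₂ ≤ Γ →
          ∃ (X : Fin 2 → ℝ → EuclideanSpace ℝ (Fin 3)) (w : Fin 2 → ℝ → ℝ) (c : Fin 2 → ℝ),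
            (∀ (u : (Fin 2 → ℝ → EuclideanSpace ℝ (Fin 3)) → EuclideanSpace ℝ (Fin 3) → EuclideanSpace ℝ (Fin 3))
              (v : EuclideanSpace ℝ (Fin 3) → EuclideanSpace ℝ (Fin 3)),
              (∀ Z y, u Z y = ∑ k, (Γ*((fun _ : Fin 2 => 125 * Real.pi / 108) k)/(4*Real.pi))•∫ σ:ℝ, ((‖y-Z k σ‖^2+Real.exp (-(1+Real.eulerMascheroniConstant-Real.log 2)))^(3/2:ℝ))⁻¹•cross (deriv (Z k) σ) (y-Z k σ)) →
              (∀ y, v y = u X y+(1/2:ℝ)•y-(875/432 : ℝ)•cross (EuclideanSpace.single 2 1) y) →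
              ((875/432 : ℝ) ≠ 0 ∧ (∀ j : Fin 2, (fun _ : Fin 2 => 125 * Real.pi / 108) j ≠ 0) ∧
               (∀ j, ContDiff ℝ 2 (X j) ∧ Differentiable ℝ (w j) ∧ (∀ τ, ‖deriv (X j) τ‖ = 1) ∧ (∀ τ, ‖iteratedDeriv 2 (X j) τ‖*√Γ≤K) ∧
                 Tendsto (fun τ => ‖X j τ‖) (cocompact ℝ) atTop) ∧
               (∀ j k, j ≠ k → ∀ τ σ, ρ*√Γ≤‖X j τ-X k σ‖) ∧ (∀ j τ σ, ρ*√Γ≤|τ-σ| → cg*ρ*√Γ≤‖X j τ-X j σ‖) ∧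
               (∀ j τ, cg*|τ-c j|≤Rw*√Γ+‖X j τ‖) ∧ (∀ j τ, w j τ = ⟪v (X j τ), deriv (X j) τ⟫_ℝ) ∧
               (∀ j τ, ‖X j τ‖≤Rb*√(Γ*Real.log Γ) → v (X j τ) = w j τ•deriv (X j) τ) ∧ (∀ j, ‖X j (c j)‖≤Rw*√Γ) ∧
               (∀ j, |⟪deriv (X j) (c j), EuclideanSpace.single 2 1⟫_ℝ|≤1-θ₀) ∧
               (θ₀≤|(875/432 : ℝ)| ∧ |(875/432 : ℝ)|≤θ₀⁻¹ ∧ ∀ j : Fin 2, θ₀≤|(fun _ : Fin 2 => 125 * Real.pi / 108) j| ∧ |(fun _ : Fin 2 => 125 * Real.pi / 108) j|≤θ₀⁻¹) ∧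
               (∀ j, w j (c j) = 0 ∧ (∀ τ, w j τ = 0 → τ = c j) ∧ 3/2+δ≤deriv (w j) (c j) ∧ deriv (w j) (c j)≤Λ))) ∧
            (∀ j τ σ, ‖deriv (X j) τ - deriv (X j) σ‖ ≤ Rb) ∧ (∀ j τ, |deriv (w j) τ| ≤ Λ))
    (h3 : Summit.NavierStokesRegularity.NavierStokesRegularity.Theses.FilamentSkeletonRss.Clause13NearStraightL) :
    Summit.NavierStokesRegularity.NavierStokesRegularity.Theses.FilamentSkeletonRss.SkeletonJ1L := by
  have h3' : Clause13NearStraightLS := route_clause13NearStraightL_iff.mp h3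
  have h4 : NormalBlockMatchedLS := route_normalBlockMatchedL_iff.mp stub_normalBlockL
  refine skeletonJ1L_iff_matrix.mpr ?_
  set γ : Fin 2 → ℝ := fun _ => 125 * Real.pi / 108 with hγ
  set α : ℝ := 875 / 432 with hα
  have hN : 0 < 2 := by norm_num
  obtain ⟨δ', ρ', K, Λ', Rw', cg, θ₀', Rb₁, hδ', hρ', hRw', hcg, hθ₀', hRb₁, hKρ, hΛ1, hfam⟩ := h1
  obtain ⟨Rb₀, hRb₀, h13⟩ := h3' 2 δ' ρ' K Λ' Rw' cg θ₀' 1 hN hδ' hρ' hRw' hcg hθ₀'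
  have hRb : 0 < min Rb₀ Rb₁ := lt_min hRb₀ hRb₁
  obtain ⟨a, b, cnd, Γ₀, ha, hcnd, h13'⟩ := h13 (min Rb₀ Rb₁) hRb (min_le_left _ _)
  obtain ⟨Γ₂, hfam'⟩ := hfam (min Rb₀ Rb₁) hRb (min_le_right _ _)
  obtain ⟨Γ₁, h12⟩ := h4 2 δ' ρ' K Λ' Rw' (min Rb₀ Rb₁) cg θ₀' 1 hN hδ' hρ' hRw' hRb hcg hθ₀' hKρ
  refine ⟨2, δ', ρ', K, Λ', a, b, cnd, 1, Rw', min Rb₀ Rb₁, cg, θ₀', 1, max Γ₂ (max Γ₀ Γ₁), hN, hδ', hρ', ha, hcnd,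
    one_pos, hRw', hRb, hcg, hθ₀', ?_⟩
  intro Γ hΓ
  have hΓ₂ : Γ₂ ≤ Γ := le_trans (le_max_left _ _) hΓ
  have hΓ₀ : Γ₀ ≤ Γ := le_trans (le_trans (le_max_left _ _) (le_max_right _ _)) hΓ
  have hΓ₁ : Γ₁ ≤ Γ := le_trans (le_trans (le_max_right _ _) (le_max_right _ _)) hΓ
  obtain ⟨X, w, c, hcl, hosc, hw'⟩ := hfam' Γ hΓ₂
  have hflat : FlatJ1L 2 δ' ρ' K Λ' Rw' (min Rb₀ Rb₁) cg θ₀' 1 Γ γ α X w c (fun _ _ => 1) := flatJ1L_of_unitCore hcl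
  have hns : NearStraightJ1G 2 Λ' (min Rb₀ Rb₁) X w (fun _ _ => 1) := nearStraightJ1G_of_unitCore hΛ1 hosc hw'
  have hc13 := h13' Γ hΓ₀ γ α X w c (fun _ _ => 1) hflat hns
  obtain ⟨m, n, hc12⟩ := h12 Γ hΓ₁ γ α X w c (fun _ _ => 1) hflat hns
  refine ⟨γ, α, X, w, c, m, n, fun _ _ => 1, ?_⟩
  intro u v A T hu hv hA hT
  obtain ⟨k0, k1, k2, k3, k4, k5, k6, k7, k8, k9, k10, k11, k12, k13⟩ := hflat u v A T hu hv hA hT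
  exact ⟨k0, k1, k2, k3, k4, k5, k6, k7, k8, k9, k10, k11, k12, k13, hc12 u v A T hu hv hA hT, hc13 u v A T hu hv hA hT⟩

end Summit.NavierStokesRegularity.NavierStokesRegularity.Theorems.SkeletonJ1LSingleDatum

end
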